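import Literature.RingTheory.MvPolynomial.NewtonPowerSums
import Literature.Analysis.Complex.AffineHypersurfaceFibres
import Literature.NumberTheory.Automorphic.HeckeLatticeCount
import HarnessLib

/-!
# The Hankel discriminant of a monic family of polynomials

Layer `Literature/RingTheory/MvPolynomial`, sequel of `NewtonPowerSums`. For the family `P = Σ_j a_j(w) X^j`,
`a_j ∈ ℂ[w₁, …, w_m]`, `P.coeff d = c ≠ 0` constant, `deg a_j + j ≤ d` (fibres `P_w` with roots
`ρ₁(w), …, ρ_d(w)`), the power sums `Σ_i ρ_i(w)^k` are POLYNOMIALS `S_k(w)` of degree `≤ k` (Newton's identities on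
the coefficients), and the **Hankel discriminant** `Δ = det (S_{i+j})_{0 ≤ i, j < d}` satisfies
`Δ(w) = det(VᵀV) = ∏_{i<j} (ρ_i(w) - ρ_j(w))²` (`V` the Vandermonde matrix of the roots), so:

* `det_hankel_eq_det_vandermonde_sq` — `det (Σ_k r_k^{i+j})_{ij} = (det V(r))²`;
* `exists_powerSums` — the polynomials `S_k`, with `S_k(w) = Σ ρ^k`, `deg S_k ≤ k`, `Δ ≠ 0`,
  `Δ(w) ≠ 0 ↔` the roots of `P_w` are distinct, and `deg Δ = d(d-1)` PROVIDED some fibre of the top-degree family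
  `P^top = Σ_j (a_j)_{(d-j)} X^j` has distinct roots (the degree-`d(d-1)` component of `Δ` is the Hankel discriminant
  of `P^top`, computed from the top components of the Newton sequence, `newtonSeq_homogeneousComponent`).

This is the algebraic half of Serre's algebraisation lemma on an affine hypersurface in Noether normal form
(GAGA n° 19–20). Everything is proved; no definitions, no named facts.

## References

* J.-P. Serre, *Géométrie algébrique et géométrie analytique*, Ann. Inst. Fourier 6 (1956), n° 19–20. [SerreGAGA1956]
-/

noncomputable section

open Polynomial Finset Matrix
open scoped BigOperators

namespace Literature.RingTheory.MvPolynomial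

namespace NewtonPowerSums

/-! ### Hankel matrices of power sums and the Vandermonde determinant -/

/-- **`Hankel = VᵀV`**: the Hankel matrix of the power sums of `r₁, …, r_d` is `VᵀV` for the Vandermonde matrix
`V_{ki} = r_k^i`, so its determinant is `(det V)² = ∏_{i<j} (r_j - r_i)²`. [cite: SerreGAGA1956, n° 19 Lemme 8] -/
theorem det_hankel_eq_det_vandermonde_sq {R : Type*} [CommRing R] {d : ℕ} (r : Fin d → R) :
    (Matrix.of fun i j : Fin d ↦ ∑ k, r k ^ (i.1 + j.1)).det = (Matrix.vandermonde r).det ^ 2 := by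
  have h : (Matrix.of fun i j : Fin d ↦ ∑ k, r k ^ (i.1 + j.1)) = (Matrix.vandermonde r)ᵀ * Matrix.vandermonde r := by
    ext i j
    simp only [Matrix.of_apply, Matrix.mul_apply, Matrix.transpose_apply, Matrix.vandermonde_apply, pow_add]
  rw [h, det_mul, det_transpose, sq]

/-- A multiset of cardinality `d` is enumerated by a function on `Fin d`. [cite: SerreGAGA1956, n° 19 Lemme 8] -/
theorem exists_enum_of_card_eq {R : Type*} (M : Multiset R) {d : ℕ} (hM : Multiset.card M = d) :
    ∃ r : Fin d → R, univ.val.map r = M := by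
  induction M using Quotient.inductionOn with
  | h l =>
    have hl : l.length = d := by simpa using hM
    subst hl
    exact ⟨l.get, by rw [Fin.univ_val_map, List.ofFn_get]; rfl⟩

/-- **The Hankel determinant of the power sums of a multiset of cardinality `d` vanishes iff the multiset has a
repeated element.** [cite: SerreGAGA1956, n° 19 Lemme 8] -/
theorem det_hankel_psum_ne_zero_iff {R : Type*} [CommRing R] [IsDomain R] (M : Multiset R) {d : ℕ}
    (hM : Multiset.card M = d) :
    (Matrix.of fun i j : Fin d ↦ (M.map (· ^ (i.1 + j.1))).sum).det ≠ 0 ↔ M.Nodup := by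
  classical
  obtain ⟨r, rfl⟩ := exists_enum_of_card_eq M hM
  have h : (Matrix.of fun i j : Fin d ↦ ((univ.val.map r).map (· ^ (i.1 + j.1))).sum) =
      Matrix.of fun i j : Fin d ↦ ∑ k, r k ^ (i.1 + j.1) := by
    ext i j
    simp only [Matrix.of_apply, Multiset.map_map, Function.comp_def, Finset.sum_eq_multiset_sum]
  rw [h, det_hankel_eq_det_vandermonde_sq, pow_ne_zero_iff two_ne_zero, Matrix.det_vandermonde_ne_zero_iff,
    Multiset.nodup_map_iff_inj_on univ.nodup]
  constructor
  · exact fun hinj x _ y _ hxy ↦ hinj hxy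
  · exact fun hinj x y hxy ↦ hinj x (mem_univ x) y (mem_univ y) hxy

/-! ### Determinants of matrices of polynomials with graded degree bounds -/

section Det

variable {σ : Type*} {R : Type*} [CommRing R]

/-- **Top component of a product with degree bounds** (finite products): if `deg f_i ≤ n_i` then the degree-`Σ n_i`
component of `∏ f_i` is `∏ (f_i)_{(n_i)}`, and `deg ∏ f_i ≤ Σ n_i`. [cite: SerreGAGA1956, n° 19 Lemme 8] -/
theorem homogeneousComponent_prod_of_le {ι : Type*} (s : Finset ι) (f : ι → MvPolynomial σ R) (n : ι → ℕ)
    (h : ∀ i ∈ s, (f i).totalDegree ≤ n i) :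
    (∏ i ∈ s, f i).totalDegree ≤ ∑ i ∈ s, n i ∧
      MvPolynomial.homogeneousComponent (∑ i ∈ s, n i) (∏ i ∈ s, f i) =
        ∏ i ∈ s, MvPolynomial.homogeneousComponent (n i) (f i) := by
  classical
  induction s using Finset.induction_on with
  | empty => simp [MvPolynomial.homogeneousComponent_zero]
  | insert a s ha ih =>
    obtain ⟨ihdeg, ihtop⟩ := ih fun i hi ↦ h i (mem_insert_of_mem hi)
    have hfa := h a (mem_insert_self a s)
    rw [prod_insert ha, prod_insert ha, sum_insert ha]
    refine ⟨(MvPolynomial.totalDegree_mul _ _).trans (add_le_add hfa ihdeg), ?_⟩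
    rw [homogeneousComponent_mul_of_le hfa ihdeg, ihtop]

/-- **Degree and top component of a determinant with graded entries**: if `deg M_{ab} ≤ r_a + c_b` for a square
matrix of polynomials, then `deg det M ≤ Σ r + Σ c` and the degree-`(Σ r + Σ c)` component of `det M` is
`det ((M_{ab})_{(r_a + c_b)})`. [cite: SerreGAGA1956, n° 19 Lemme 8] -/
theorem det_homogeneousComponent_of_weights {ι : Type*} [Fintype ι] [DecidableEq ι]
    (M : Matrix ι ι (MvPolynomial σ R)) (r c : ι → ℕ) (hM : ∀ a b, (M a b).totalDegree ≤ r a + c b) :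
    M.det.totalDegree ≤ ∑ a, r a + ∑ b, c b ∧
      MvPolynomial.homogeneousComponent (∑ a, r a + ∑ b, c b) M.det =
        (Matrix.of fun a b ↦ MvPolynomial.homogeneousComponent (r a + c b) (M a b)).det := by
  classical
  have hsum : ∀ τ : Equiv.Perm ι, ∑ b, (r (τ b) + c b) = ∑ a, r a + ∑ b, c b := by
    intro τ
    rw [sum_add_distrib, Equiv.sum_comp τ r]
  have hterm : ∀ τ : Equiv.Perm ι, (∏ b, M (τ b) b).totalDegree ≤ ∑ a, r a + ∑ b, c b ∧
      MvPolynomial.homogeneousComponent (∑ a, r a + ∑ b, c b) (∏ b, M (τ b) b) =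
        ∏ b, MvPolynomial.homogeneousComponent (r (τ b) + c b) (M (τ b) b) := by
    intro τ
    have := homogeneousComponent_prod_of_le univ (fun b ↦ M (τ b) b) (fun b ↦ r (τ b) + c b)
      fun b _ ↦ hM (τ b) b
    rwa [hsum τ] at this
  have hsmul : ∀ (τ : Equiv.Perm ι) (p : MvPolynomial σ R) (n : ℕ),
      MvPolynomial.homogeneousComponent n (Equiv.Perm.sign τ • p) =
        Equiv.Perm.sign τ • MvPolynomial.homogeneousComponent n p := by
    intro τ p n
    rw [Units.smul_def, Units.smul_def, map_zsmul]
  constructor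
  · rw [det_apply]
    refine (MvPolynomial.totalDegree_finsetSum _ _).trans (Finset.sup_le fun τ _ ↦ ?_)
    rw [Units.smul_def]
    refine le_trans ?_ (hterm τ).1
    rcases Int.units_eq_one_or (Equiv.Perm.sign τ) with h1 | h1 <;> rw [h1]
    · simp
    · rw [Units.val_neg, Units.val_one, neg_smul, one_smul, MvPolynomial.totalDegree_neg]
  · rw [det_apply, det_apply, map_sum]
    refine sum_congr rfl fun τ _ ↦ ?_
    rw [hsmul, (hterm τ).2]
    rfl

/-- `Σ_{a < d} a = d(d-1)/2`, in the form `2 Σ a = d(d-1)` over `Fin d`. [folklore] -/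
private theorem two_mul_sum_fin_val (d : ℕ) : ∑ a : Fin d, a.1 + ∑ a : Fin d, a.1 = d * (d - 1) := by
  have h := Fin.sum_univ_eq_sum_range (fun i ↦ i) d
  rw [← two_mul, h, mul_comm, Finset.sum_range_id_mul_two]

/-- **Degree and top component of a Hankel-graded determinant**: if `deg M_{ij} ≤ i + j` for a `d × d` matrix of
polynomials (indices `0, …, d-1`), then `deg det M ≤ d(d-1)` and the degree-`d(d-1)` component of `det M` is
`det ((M_{ij})_{(i+j)})`. [cite: SerreGAGA1956, n° 19 Lemme 8] -/
theorem det_homogeneousComponent_of_le {d : ℕ} (M : Matrix (Fin d) (Fin d) (MvPolynomial σ R))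
    (hM : ∀ i j, (M i j).totalDegree ≤ i.1 + j.1) :
    M.det.totalDegree ≤ d * (d - 1) ∧
      MvPolynomial.homogeneousComponent (d * (d - 1)) M.det =
        (Matrix.of fun i j ↦ MvPolynomial.homogeneousComponent (i.1 + j.1) (M i j)).det := by
  have := det_homogeneousComponent_of_weights M (fun i ↦ i.1) (fun j ↦ j.1) hM
  rwa [two_mul_sum_fin_val] at this

/-- **Degrees of the adjugate of a Hankel-graded matrix**: if `deg M_{ij} ≤ i + j` then
`deg (adj M)_{ij} + i + j ≤ d(d-1)` (cofactor expansion: `(adj M)_{ij} = ± det` of `M` with row `j` and column `i`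
deleted). [cite: SerreGAGA1956, n° 20] -/
theorem totalDegree_adjugate_add_le {d : ℕ} (M : Matrix (Fin d) (Fin d) (MvPolynomial σ R))
    (hM : ∀ i j, (M i j).totalDegree ≤ i.1 + j.1) (i j : Fin d) :
    (M.adjugate i j).totalDegree + i.1 + j.1 ≤ d * (d - 1) := by
  classical
  cases d with
  | zero => exact i.elim0
  | succ n =>
    rw [Matrix.adjugate_fin_succ_eq_det_submatrix]
    have hsub := (det_homogeneousComponent_of_weights (M.submatrix j.succAbove i.succAbove)
      (fun a ↦ (j.succAbove a).1) (fun b ↦ (i.succAbove b).1) fun a b ↦ hM _ _).1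
    have hj : ∑ a : Fin n, (j.succAbove a).1 + j.1 = ∑ x : Fin (n + 1), x.1 := by
      rw [Fin.sum_univ_succAbove (fun x : Fin (n + 1) ↦ x.1) j, add_comm]
    have hi : ∑ b : Fin n, (i.succAbove b).1 + i.1 = ∑ x : Fin (n + 1), x.1 := by
      rw [Fin.sum_univ_succAbove (fun x : Fin (n + 1) ↦ x.1) i, add_comm]
    have htot := two_mul_sum_fin_val (n + 1)
    have hsign : ((-1 : MvPolynomial σ R) ^ (j.1 + i.1 : ℕ)).totalDegree = 0 := by
      rw [show ((-1 : MvPolynomial σ R) ^ (j.1 + i.1 : ℕ)) = MvPolynomial.C ((-1) ^ (j.1 + i.1)) by simp,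
        MvPolynomial.totalDegree_C]
    have h1 := MvPolynomial.totalDegree_mul ((-1 : MvPolynomial σ R) ^ (j.1 + i.1 : ℕ))
      (M.submatrix j.succAbove i.succAbove).det
    rw [hsign, zero_add] at h1
    omega

end Det


/-! ### The power-sum polynomials of a monic family and their Hankel discriminant -/

section Family

open Literature.Analysis.Complex.AffineHypersurface

variable {m d : ℕ} {c : ℂ} (P : Polynomial (MvPolynomial (Fin m) ℂ))

/-- **Vieta for the fibres**: with `E_i = (-1)^i c⁻¹ a_{d-i}` (`i ≤ d`; `E_i = 0` for `i > d`),
`E_i(w) = e_i(roots of P_w)`. [cite: SerreGAGA1956, n° 19 Lemme 8] -/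
theorem eval_esymmData (hc : c ≠ 0) (hPd : P.natDegree ≤ d) (hPlead : P.coeff d = MvPolynomial.C c)
    (i : ℕ) (w : Fin m → ℂ) :
    MvPolynomial.eval w (if i ≤ d then (-1) ^ i * MvPolynomial.C c⁻¹ * P.coeff (d - i) else 0) =
      (P.map (MvPolynomial.eval w)).roots.esymm i := by
  obtain ⟨hdeg, hlc⟩ := natDegree_map_eval_eq P hc hPd hPlead w
  have hcard := card_roots_map_eval P hc hPd hPlead w
  split_ifs with hi
  · have hv := Polynomial.coeff_eq_esymm_roots_of_card (hcard.trans hdeg.symm) (k := d - i) (by rw [hdeg]; omega)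
    rw [hdeg, hlc, show d - (d - i) = i by omega, coeff_map] at hv
    rw [map_mul, map_mul, map_pow, map_neg, map_one, MvPolynomial.eval_C, hv]
    have h1 : ((-1 : ℂ) ^ i) * (-1) ^ i = 1 := by rw [← pow_add, ← two_mul, pow_mul]; simp
    calc (-1 : ℂ) ^ i * c⁻¹ * (c * (-1) ^ i * (P.map (MvPolynomial.eval w)).roots.esymm i)
        = (c⁻¹ * c) * (((-1 : ℂ) ^ i) * (-1) ^ i) * (P.map (MvPolynomial.eval w)).roots.esymm i := by ring
      _ = _ := by rw [inv_mul_cancel₀ hc, h1, one_mul, one_mul]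
  · rw [map_zero, Literature.NumberTheory.Automorphic.multiset_esymm_eq_zero_of_card_lt _ (by rw [hcard]; omega)]

/-- The data `E_i` have degree `≤ i` when `deg a_j + j ≤ d`. [cite: SerreGAGA1956, n° 19 Lemme 8] -/
theorem totalDegree_esymmData_le (hPcoef : ∀ j, (P.coeff j).totalDegree + j ≤ d) (i : ℕ) :
    (if i ≤ d then (-1) ^ i * MvPolynomial.C c⁻¹ * P.coeff (d - i) else (0 : MvPolynomial (Fin m) ℂ)).totalDegree
      ≤ i := by
  split_ifs with hi
  · have h1 : ((-1 : MvPolynomial (Fin m) ℂ) ^ i * MvPolynomial.C c⁻¹).totalDegree = 0 := by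
      rw [show ((-1 : MvPolynomial (Fin m) ℂ) ^ i * MvPolynomial.C c⁻¹) = MvPolynomial.C ((-1) ^ i * c⁻¹) by simp,
        MvPolynomial.totalDegree_C]
    refine (MvPolynomial.totalDegree_mul _ _).trans ?_
    rw [h1, zero_add]
    have := hPcoef (d - i)
    omega
  · simp

/-- **A Newton sequence on the data `E_i` of the family evaluates to the power sums of the roots of the fibres.**
[cite: SerreGAGA1956, n° 19 Lemme 8] -/
theorem eval_newtonSeq_eq_psum (hc : c ≠ 0) (hPd : P.natDegree ≤ d) (hPlead : P.coeff d = MvPolynomial.C c)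
    {S : ℕ → MvPolynomial (Fin m) ℂ} (h0 : S 0 = MvPolynomial.C (d : ℂ))
    (hS : ∀ k, 0 < k → S k = (-1) ^ (k + 1) * k *
        (if k ≤ d then (-1) ^ k * MvPolynomial.C c⁻¹ * P.coeff (d - k) else 0) -
      ∑ a ∈ antidiagonal k with a.1 ∈ Set.Ioo 0 k,
        (-1) ^ a.1 * (if a.1 ≤ d then (-1) ^ a.1 * MvPolynomial.C c⁻¹ * P.coeff (d - a.1) else 0) * S a.2)
    (k : ℕ) (w : Fin m → ℂ) :
    MvPolynomial.eval w (S k) = (((P.map (MvPolynomial.eval w)).roots).map (· ^ k)).sum := by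
  refine newtonSeq_eq_psum (P.map (MvPolynomial.eval w)).roots (e := fun i ↦ MvPolynomial.eval w
      (if i ≤ d then (-1) ^ i * MvPolynomial.C c⁻¹ * P.coeff (d - i) else 0)) (s := fun k ↦ MvPolynomial.eval w (S k))
    (fun i ↦ eval_esymmData P hc hPd hPlead i w) ?_ (fun k hk ↦ ?_) k
  · simp only [h0, MvPolynomial.eval_C, card_roots_map_eval P hc hPd hPlead]
  · simp only [hS k hk, map_sub, map_sum, map_mul, map_pow, map_neg, map_one, map_natCast]

/-- **The power-sum polynomials and the Hankel discriminant of a monic family** (the algebraic half of Serre's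
algebraisation lemma in Noether normal form). For `P = Σ a_j(w) X^j` with `P.coeff d = c ≠ 0` constant and
`deg a_j + j ≤ d`, there are `S_k ∈ ℂ[w]` with `S_k(w) = Σ_{P_w(ρ)=0} ρ^k` (multiplicities counted) and `deg S_k ≤ k`,
whose Hankel determinant `Δ = det (S_{i+j})_{i,j<d}` is non-zero, detects multiple roots (`Δ(w) ≠ 0 ↔` the roots of
`P_w` are distinct) and has degree EXACTLY `d(d-1)` — provided one fibre of the top-degree family
`Σ_j (a_j)_{(d-j)} X^j` has distinct roots. [cite: SerreGAGA1956, n° 19 Lemme 8 and n° 20] -/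
theorem exists_powerSums (hc : c ≠ 0) (hPd : P.natDegree ≤ d) (hPlead : P.coeff d = MvPolynomial.C c)
    (hPcoef : ∀ j, (P.coeff j).totalDegree + j ≤ d)
    (hsep : ∃ w₀ : Fin m → ℂ, ((∑ j ∈ range (d + 1), Polynomial.monomial j
      (MvPolynomial.homogeneousComponent (d - j) (P.coeff j))).map (MvPolynomial.eval w₀)).roots.Nodup) :
    ∃ S : ℕ → MvPolynomial (Fin m) ℂ,
      (∀ k w, MvPolynomial.eval w (S k) = (((P.map (MvPolynomial.eval w)).roots).map (· ^ k)).sum) ∧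
      (∀ k, (S k).totalDegree ≤ k) ∧
      (Matrix.of fun i j : Fin d ↦ S (i.1 + j.1)).det.totalDegree = d * (d - 1) ∧
      (Matrix.of fun i j : Fin d ↦ S (i.1 + j.1)).det ≠ 0 ∧
      ∀ w, MvPolynomial.eval w (Matrix.of fun i j : Fin d ↦ S (i.1 + j.1)).det ≠ 0 ↔
        (P.map (MvPolynomial.eval w)).roots.Nodup := by
  classical
  -- the data and the Newton sequence
  set E : ℕ → MvPolynomial (Fin m) ℂ := fun i ↦
    if i ≤ d then (-1) ^ i * MvPolynomial.C c⁻¹ * P.coeff (d - i) else 0 with hE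
  have hEdeg : ∀ i, (E i).totalDegree ≤ i := totalDegree_esymmData_le P hPcoef
  obtain ⟨S, hS0, hSrec⟩ := exists_newtonSeq E (MvPolynomial.C (d : ℂ))
  have hS0deg : (S 0).totalDegree = 0 := by rw [hS0, MvPolynomial.totalDegree_C]
  have hSeval : ∀ k w, MvPolynomial.eval w (S k) = (((P.map (MvPolynomial.eval w)).roots).map (· ^ k)).sum :=
    fun k w ↦ eval_newtonSeq_eq_psum P hc hPd hPlead hS0 hSrec k w
  have hSdeg : ∀ k, (S k).totalDegree ≤ k := totalDegree_newtonSeq_le hEdeg hS0deg hSrec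
  -- the Hankel determinant: evaluation, degree bound, top component
  set H : Matrix (Fin d) (Fin d) (MvPolynomial (Fin m) ℂ) := Matrix.of fun i j : Fin d ↦ S (i.1 + j.1) with hH
  have hHeval : ∀ w, MvPolynomial.eval w H.det =
      (Matrix.of fun i j : Fin d ↦ (((P.map (MvPolynomial.eval w)).roots).map (· ^ (i.1 + j.1))).sum).det := by
    intro w
    rw [RingHom.map_det]
    congr 1
    ext i j
    simp [hH, hSeval]
  have hnodup : ∀ w, MvPolynomial.eval w H.det ≠ 0 ↔ (P.map (MvPolynomial.eval w)).roots.Nodup := fun w ↦ by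
    rw [hHeval]
    exact det_hankel_psum_ne_zero_iff _ (card_roots_map_eval P hc hPd hPlead w)
  obtain ⟨hdegle, htop⟩ := det_homogeneousComponent_of_le H fun i j ↦ by simpa [hH] using hSdeg (i.1 + j.1)
  -- the top-degree family and its Newton sequence
  set Pt : Polynomial (MvPolynomial (Fin m) ℂ) := ∑ j ∈ range (d + 1), Polynomial.monomial j
    (MvPolynomial.homogeneousComponent (d - j) (P.coeff j)) with hPt
  have hPtcoeff : ∀ n, Pt.coeff n = if n ≤ d then MvPolynomial.homogeneousComponent (d - n) (P.coeff n) else 0 := by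
    intro n
    rw [hPt, finsetSum_coeff]
    simp only [coeff_monomial]
    split_ifs with hn
    · rw [sum_eq_single n (fun j _ hj ↦ if_neg hj) (fun h ↦ absurd (mem_range.mpr (by omega)) h), if_pos rfl]
    · exact sum_eq_zero fun j hj ↦ if_neg (by rw [mem_range] at hj; omega)
  have hPtlead : Pt.coeff d = MvPolynomial.C c := by
    rw [hPtcoeff, if_pos le_rfl, Nat.sub_self, hPlead, MvPolynomial.homogeneousComponent_zero, MvPolynomial.coeff_C,
      if_pos rfl]
  have hPtd : Pt.natDegree ≤ d := by
    rw [natDegree_le_iff_coeff_eq_zero]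
    intro n hn
    have hn' : ¬ n ≤ d := by exact_mod_cast not_le.mpr hn
    rw [hPtcoeff, if_neg hn']
  set S' : ℕ → MvPolynomial (Fin m) ℂ := fun k ↦ MvPolynomial.homogeneousComponent k (S k) with hS'
  have hS'0 : S' 0 = MvPolynomial.C (d : ℂ) := by
    simp only [hS', hS0, MvPolynomial.homogeneousComponent_zero, MvPolynomial.coeff_C, if_pos]
  have hE' : ∀ i, MvPolynomial.homogeneousComponent i (E i) =
      if i ≤ d then (-1) ^ i * MvPolynomial.C c⁻¹ * Pt.coeff (d - i) else 0 := by
    intro i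
    simp only [hE]
    split_ifs with hi
    · rw [hPtcoeff, if_pos (Nat.sub_le d i), show d - (d - i) = i by omega,
        show ((-1 : MvPolynomial (Fin m) ℂ) ^ i * MvPolynomial.C c⁻¹) = MvPolynomial.C ((-1) ^ i * c⁻¹) by simp,
        MvPolynomial.homogeneousComponent_C_mul]
    · simp
  have hS'rec : ∀ k, 0 < k → S' k = (-1) ^ (k + 1) * k *
        (if k ≤ d then (-1) ^ k * MvPolynomial.C c⁻¹ * Pt.coeff (d - k) else 0) -
      ∑ a ∈ antidiagonal k with a.1 ∈ Set.Ioo 0 k,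
        (-1) ^ a.1 * (if a.1 ≤ d then (-1) ^ a.1 * MvPolynomial.C c⁻¹ * Pt.coeff (d - a.1) else 0) * S' a.2 := by
    intro k hk
    have := newtonSeq_homogeneousComponent hEdeg hS0deg hSrec k hk
    simp only [hS', hE'] at this ⊢
    exact this
  have hS'eval : ∀ k w, MvPolynomial.eval w (S' k) = (((Pt.map (MvPolynomial.eval w)).roots).map (· ^ k)).sum :=
    fun k w ↦ eval_newtonSeq_eq_psum Pt hc hPtd hPtlead hS'0 hS'rec k w
  -- the top component of `Δ` is the Hankel discriminant of the top family, non-zero at `w₀`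
  obtain ⟨w₀, hw₀⟩ := hsep
  have htopeval : MvPolynomial.eval w₀ (MvPolynomial.homogeneousComponent (d * (d - 1)) H.det) ≠ 0 := by
    rw [htop, RingHom.map_det]
    have : (MvPolynomial.eval w₀).mapMatrix
        (Matrix.of fun i j : Fin d ↦ MvPolynomial.homogeneousComponent (i.1 + j.1) (H i j)) =
        Matrix.of fun i j : Fin d ↦ (((Pt.map (MvPolynomial.eval w₀)).roots).map (· ^ (i.1 + j.1))).sum := by
      ext i j
      rw [RingHom.mapMatrix_apply, Matrix.map_apply, Matrix.of_apply, Matrix.of_apply, ← hS'eval, hS', hH,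
        Matrix.of_apply]
    rw [this]
    exact (det_hankel_psum_ne_zero_iff _ (card_roots_map_eval Pt hc hPtd hPtlead w₀)).mpr hw₀
  have htopne : MvPolynomial.homogeneousComponent (d * (d - 1)) H.det ≠ 0 := fun h ↦ by
    rw [h, map_zero] at htopeval; exact htopeval rfl
  have hdeg : H.det.totalDegree = d * (d - 1) := by
    refine le_antisymm hdegle (not_lt.mp fun hlt ↦ htopne (MvPolynomial.homogeneousComponent_eq_zero _ _ hlt))
  have hne : H.det ≠ 0 := fun h ↦ htopne (by rw [h, map_zero])
  exact ⟨S, hSeval, hSdeg, hdeg, hne, hnodup⟩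

end Family


section FamilyCorrected

open Literature.Analysis.Complex.AffineHypersurface

variable {m d : ℕ} {c : ℂ} (P : Polynomial (MvPolynomial (Fin m) ℂ))

/-- The data `E_i` have degree `≤ i` when `deg a_j ≤ d - j` (usable form of `totalDegree_esymmData_le`). [cite: SerreGAGA1956, n° 19 Lemme 8] -/
theorem totalDegree_esymmData_le' (hPcoef : ∀ j, (P.coeff j).totalDegree ≤ d - j) (i : ℕ) :
    (if i ≤ d then (-1) ^ i * MvPolynomial.C c⁻¹ * P.coeff (d - i) else (0 : MvPolynomial (Fin m) ℂ)).totalDegree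
      ≤ i := by
  split_ifs with hi
  · have h1 : ((-1 : MvPolynomial (Fin m) ℂ) ^ i * MvPolynomial.C c⁻¹).totalDegree = 0 := by
      rw [show ((-1 : MvPolynomial (Fin m) ℂ) ^ i * MvPolynomial.C c⁻¹) = MvPolynomial.C ((-1) ^ i * c⁻¹) by simp,
        MvPolynomial.totalDegree_C]
    refine (MvPolynomial.totalDegree_mul _ _).trans ?_
    rw [h1, zero_add]
    have := hPcoef (d - i)
    omega
  · simp

/-- **The power-sum polynomials and the Hankel discriminant of a monic family**, usable form of `exists_powerSums` with the
coefficient hypothesis `deg a_j ≤ d - j` (the unprimed `∀ j, deg a_j + j ≤ d` cannot be met for `j > d`) (the algebraic half of Serre's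
algebraisation lemma in Noether normal form). For `P = Σ a_j(w) X^j` with `P.coeff d = c ≠ 0` constant and
`deg a_j + j ≤ d`, there are `S_k ∈ ℂ[w]` with `S_k(w) = Σ_{P_w(ρ)=0} ρ^k` (multiplicities counted) and `deg S_k ≤ k`,
whose Hankel determinant `Δ = det (S_{i+j})_{i,j<d}` is non-zero, detects multiple roots (`Δ(w) ≠ 0 ↔` the roots of
`P_w` are distinct) and has degree EXACTLY `d(d-1)` — provided one fibre of the top-degree family
`Σ_j (a_j)_{(d-j)} X^j` has distinct roots. [cite: SerreGAGA1956, n° 19 Lemme 8 and n° 20] -/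
theorem exists_powerSums' (hc : c ≠ 0) (hPd : P.natDegree ≤ d) (hPlead : P.coeff d = MvPolynomial.C c)
    (hPcoef : ∀ j, (P.coeff j).totalDegree ≤ d - j)
    (hsep : ∃ w₀ : Fin m → ℂ, ((∑ j ∈ range (d + 1), Polynomial.monomial j
      (MvPolynomial.homogeneousComponent (d - j) (P.coeff j))).map (MvPolynomial.eval w₀)).roots.Nodup) :
    ∃ S : ℕ → MvPolynomial (Fin m) ℂ,
      (∀ k w, MvPolynomial.eval w (S k) = (((P.map (MvPolynomial.eval w)).roots).map (· ^ k)).sum) ∧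
      (∀ k, (S k).totalDegree ≤ k) ∧
      (Matrix.of fun i j : Fin d ↦ S (i.1 + j.1)).det.totalDegree = d * (d - 1) ∧
      (Matrix.of fun i j : Fin d ↦ S (i.1 + j.1)).det ≠ 0 ∧
      ∀ w, MvPolynomial.eval w (Matrix.of fun i j : Fin d ↦ S (i.1 + j.1)).det ≠ 0 ↔
        (P.map (MvPolynomial.eval w)).roots.Nodup := by
  classical
  -- the data and the Newton sequence
  set E : ℕ → MvPolynomial (Fin m) ℂ := fun i ↦
    if i ≤ d then (-1) ^ i * MvPolynomial.C c⁻¹ * P.coeff (d - i) else 0 with hE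
  have hEdeg : ∀ i, (E i).totalDegree ≤ i := totalDegree_esymmData_le' P hPcoef
  obtain ⟨S, hS0, hSrec⟩ := exists_newtonSeq E (MvPolynomial.C (d : ℂ))
  have hS0deg : (S 0).totalDegree = 0 := by rw [hS0, MvPolynomial.totalDegree_C]
  have hSeval : ∀ k w, MvPolynomial.eval w (S k) = (((P.map (MvPolynomial.eval w)).roots).map (· ^ k)).sum :=
    fun k w ↦ eval_newtonSeq_eq_psum P hc hPd hPlead hS0 hSrec k w
  have hSdeg : ∀ k, (S k).totalDegree ≤ k := totalDegree_newtonSeq_le hEdeg hS0deg hSrec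
  -- the Hankel determinant: evaluation, degree bound, top component
  set H : Matrix (Fin d) (Fin d) (MvPolynomial (Fin m) ℂ) := Matrix.of fun i j : Fin d ↦ S (i.1 + j.1) with hH
  have hHeval : ∀ w, MvPolynomial.eval w H.det =
      (Matrix.of fun i j : Fin d ↦ (((P.map (MvPolynomial.eval w)).roots).map (· ^ (i.1 + j.1))).sum).det := by
    intro w
    rw [RingHom.map_det]
    congr 1
    ext i j
    simp [hH, hSeval]
  have hnodup : ∀ w, MvPolynomial.eval w H.det ≠ 0 ↔ (P.map (MvPolynomial.eval w)).roots.Nodup := fun w ↦ by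
    rw [hHeval]
    exact det_hankel_psum_ne_zero_iff _ (card_roots_map_eval P hc hPd hPlead w)
  obtain ⟨hdegle, htop⟩ := det_homogeneousComponent_of_le H fun i j ↦ by simpa [hH] using hSdeg (i.1 + j.1)
  -- the top-degree family and its Newton sequence
  set Pt : Polynomial (MvPolynomial (Fin m) ℂ) := ∑ j ∈ range (d + 1), Polynomial.monomial j
    (MvPolynomial.homogeneousComponent (d - j) (P.coeff j)) with hPt
  have hPtcoeff : ∀ n, Pt.coeff n = if n ≤ d then MvPolynomial.homogeneousComponent (d - n) (P.coeff n) else 0 := by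
    intro n
    rw [hPt, finsetSum_coeff]
    simp only [coeff_monomial]
    split_ifs with hn
    · rw [sum_eq_single n (fun j _ hj ↦ if_neg hj) (fun h ↦ absurd (mem_range.mpr (by omega)) h), if_pos rfl]
    · exact sum_eq_zero fun j hj ↦ if_neg (by rw [mem_range] at hj; omega)
  have hPtlead : Pt.coeff d = MvPolynomial.C c := by
    rw [hPtcoeff, if_pos le_rfl, Nat.sub_self, hPlead, MvPolynomial.homogeneousComponent_zero, MvPolynomial.coeff_C,
      if_pos rfl]
  have hPtd : Pt.natDegree ≤ d := by
    rw [natDegree_le_iff_coeff_eq_zero]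
    intro n hn
    have hn' : ¬ n ≤ d := by exact_mod_cast not_le.mpr hn
    rw [hPtcoeff, if_neg hn']
  set S' : ℕ → MvPolynomial (Fin m) ℂ := fun k ↦ MvPolynomial.homogeneousComponent k (S k) with hS'
  have hS'0 : S' 0 = MvPolynomial.C (d : ℂ) := by
    simp only [hS', hS0, MvPolynomial.homogeneousComponent_zero, MvPolynomial.coeff_C, if_pos]
  have hE' : ∀ i, MvPolynomial.homogeneousComponent i (E i) =
      if i ≤ d then (-1) ^ i * MvPolynomial.C c⁻¹ * Pt.coeff (d - i) else 0 := by
    intro i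
    simp only [hE]
    split_ifs with hi
    · rw [hPtcoeff, if_pos (Nat.sub_le d i), show d - (d - i) = i by omega,
        show ((-1 : MvPolynomial (Fin m) ℂ) ^ i * MvPolynomial.C c⁻¹) = MvPolynomial.C ((-1) ^ i * c⁻¹) by simp,
        MvPolynomial.homogeneousComponent_C_mul]
    · simp
  have hS'rec : ∀ k, 0 < k → S' k = (-1) ^ (k + 1) * k *
        (if k ≤ d then (-1) ^ k * MvPolynomial.C c⁻¹ * Pt.coeff (d - k) else 0) -
      ∑ a ∈ antidiagonal k with a.1 ∈ Set.Ioo 0 k,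
        (-1) ^ a.1 * (if a.1 ≤ d then (-1) ^ a.1 * MvPolynomial.C c⁻¹ * Pt.coeff (d - a.1) else 0) * S' a.2 := by
    intro k hk
    have := newtonSeq_homogeneousComponent hEdeg hS0deg hSrec k hk
    simp only [hS', hE'] at this ⊢
    exact this
  have hS'eval : ∀ k w, MvPolynomial.eval w (S' k) = (((Pt.map (MvPolynomial.eval w)).roots).map (· ^ k)).sum :=
    fun k w ↦ eval_newtonSeq_eq_psum Pt hc hPtd hPtlead hS'0 hS'rec k w
  -- the top component of `Δ` is the Hankel discriminant of the top family, non-zero at `w₀`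
  obtain ⟨w₀, hw₀⟩ := hsep
  have htopeval : MvPolynomial.eval w₀ (MvPolynomial.homogeneousComponent (d * (d - 1)) H.det) ≠ 0 := by
    rw [htop, RingHom.map_det]
    have : (MvPolynomial.eval w₀).mapMatrix
        (Matrix.of fun i j : Fin d ↦ MvPolynomial.homogeneousComponent (i.1 + j.1) (H i j)) =
        Matrix.of fun i j : Fin d ↦ (((Pt.map (MvPolynomial.eval w₀)).roots).map (· ^ (i.1 + j.1))).sum := by
      ext i j
      rw [RingHom.mapMatrix_apply, Matrix.map_apply, Matrix.of_apply, Matrix.of_apply, ← hS'eval, hS', hH,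
        Matrix.of_apply]
    rw [this]
    exact (det_hankel_psum_ne_zero_iff _ (card_roots_map_eval Pt hc hPtd hPtlead w₀)).mpr hw₀
  have htopne : MvPolynomial.homogeneousComponent (d * (d - 1)) H.det ≠ 0 := fun h ↦ by
    rw [h, map_zero] at htopeval; exact htopeval rfl
  have hdeg : H.det.totalDegree = d * (d - 1) := by
    refine le_antisymm hdegle (not_lt.mp fun hlt ↦ htopne (MvPolynomial.homogeneousComponent_eq_zero _ _ hlt))
  have hne : H.det ≠ 0 := fun h ↦ htopne (by rw [h, map_zero])
  exact ⟨S, hSeval, hSdeg, hdeg, hne, hnodup⟩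

end FamilyCorrected

end NewtonPowerSums

end Literature.RingTheory.MvPolynomial
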